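import Summits.BirchSwinnertonDyer.BirchSwinnertonDyer.Theses.UniversalToricDescent
import Summits.BirchSwinnertonDyer.Rank1Residual.GaloisImage.TorsionIsoImageObstruction
import HarnessLib

/-!
# Route UniversalToricDescent, crux `ToricTransportModThree` (item stmt-BirchSwinnertonDyer-20186):
# the line `birth` reduced against the route's own crux #3 `TwinSplitIMCAtThree`

Lead-prover memo (seat bsd-wall-utd-p1 g0, 2026-08-27), kernel-checked, sorry-free. Three facts of
pure logic (four theorems) about the registered birth skeleton (stubs `stub_semistableSpread`, `stub_wildDescent`,
`ledger skeleton check` sha16 a3b67aa1cd960060):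

* `hasSurjectiveModNGaloisRep_of_modPCongruent` — a semistable twin `W″` of the wild curve `W`
  (`ModPCongruent W″ W 3`) inherits `ρ̄₃` onto from `W` (the tree's
  `GaloisImage.hasSurjectiveModNGaloisRep_of_torsionIso` along the inverse isomorphism).
* `semistableSpread_of_twinSplitIMCAtThree` — the SPREAD stub is implied BY NAME by crux #3
  `TwinSplitIMCAtThree` (item 20214) applied to the target twin `W″` (semistable at 3, onto mod 3 by
  the previous lemma, conductor `N″`, Heegner `(N″, K)`, same `(κ, γ, 𝔭, 𝔭′, ι′)`): inside the ROUTE the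
  spread carries no content beyond crux #3.
* `wildDescent_of_toricTransportModThree` / `toricTransportModThree_of_twinSplitIMCAtThree_of_wildDescent`
  — the DESCENT stub (IMC at every semistable onto twin with Heegner level over `K` ⟹ IMC at `W`) is
  implied by the crux as stated, and conversely gives the crux back granted crux #3; i.e. modulo
  `TwinSplitIMCAtThree` (which the kernel `ToricKernelAtThree` receives anyway) the crux
  `ToricTransportModThree` is EQUIVALENT to its descent stub. Consequence for the planner: the crux
  may be restated in descent form (all-twins hypothesis) at zero cost to `closes`, and the line's only
  load-bearing content is `stub_wildDescent` (the line card's own assessment, birth.md sha16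
  23eeca719febb817: no universal `(∅,0)` zeta element over `T^Σ_𝔪ρ̄ ⊗̂ Λ_ac` in print — Fouquet 2025
  Thm 1.7, tree fact `Fouquet2025.charIdeal_eq_padicLFunction_of_ordinaryCongruence`, is cyclotomic).

Nothing here closes an item; no definition, no named fact, no `sorry`.
-/

noncomputable section

open scoped Classical

set_option linter.dupNamespace false

namespace Summit.BirchSwinnertonDyer.BirchSwinnertonDyer.Theorems.UniversalToricDescentReduction

open Summit.BirchSwinnertonDyer.BirchSwinnertonDyer.Theses.UniversalToricDescent
open Summit.BirchSwinnertonDyer.Rank1Residual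

/-- `ρ̄_{W,p}` onto and a `Γ_ℚ`-equivariant isomorphism `W″[p] ≃ W[p]` (`O6.ModPCongruent W″ W p`) give
`ρ̄_{W″,p}` onto (transport along the inverse isomorphism, which is again equivariant).
Serre (1972) §2.4. [folklore] -/
theorem hasSurjectiveModNGaloisRep_of_modPCongruent {W W'' : WeierstrassCurve ℚ} {p : ℕ}
    (hcong : O6.ModPCongruent W'' W p) (h : W.HasSurjectiveModNGaloisRep p) :
    W''.HasSurjectiveModNGaloisRep p := by
  obtain ⟨e, he⟩ := hcong
  refine GaloisImage.hasSurjectiveModNGaloisRep_of_torsionIso e.symm (fun σ Q ↦ ?_) h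
  apply e.injective
  rw [he, e.apply_symm_apply, e.apply_symm_apply]

/-- **The spread stub of line `birth` follows from crux #3 `TwinSplitIMCAtThree` by name**: the target
twin `W″` is semistable at `3`, has `ρ̄₃` onto (transported from `W`), conductor `N″` and a Heegner level
over `K`, so crux #3 at `(W″, N″, K, Dt″, κ, γ, 𝔭, 𝔭′, ι′)` yields the equality for every frame of
`f_{W″}`; the hypotheses about `W′` are not even used. [folklore] -/
theorem semistableSpread_of_twinSplitIMCAtThree (hI : TwinSplitIMCAtThree) :
  ∀ (W : WeierstrassCurve ℚ) [W.IsElliptic] [W.IsGloballyMinimal]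
    (W' : WeierstrassCurve ℚ) [W'.IsElliptic] [W'.IsGloballyMinimal]
    (W'' : WeierstrassCurve ℚ) [W''.IsElliptic] [W''.IsGloballyMinimal]
    (N N' N'' : ℕ) [NeZero N] [NeZero N'] [NeZero N''] (K : Type) [Field K] [NumberField K]
    (Dt' : Literature.NumberTheory.EllipticCurves.ModularForms.ModularParametrizationData W' N') (Dt'' : Literature.NumberTheory.EllipticCurves.ModularForms.ModularParametrizationData W'' N''),
    Summit.BirchSwinnertonDyer.Rank1Residual.Additive.ClassO6 W 3 → W.HasSurjectiveModNGaloisRep 3 →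
    W.analyticRank = 1 → W.conductorNorm ℤ = N →
    Summit.BirchSwinnertonDyer.Rank1Residual.O6.ModPCongruent W' W 3 →
    ¬ Literature.NumberTheory.EllipticCurves.Rank1Residual.Addv W' 3 → W'.conductorNorm ℤ = N' →
    Summit.BirchSwinnertonDyer.Rank1Residual.O6.ModPCongruent W'' W 3 →
    ¬ Literature.NumberTheory.EllipticCurves.Rank1Residual.Addv W'' 3 → W''.conductorNorm ℤ = N'' →
    Literature.NumberTheory.EllipticCurves.IsImaginaryQuadratic K →
    Literature.NumberTheory.EllipticCurves.SatisfiesHeegnerHypothesis N K →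
    Literature.NumberTheory.EllipticCurves.SatisfiesHeegnerHypothesis N' K →
    Literature.NumberTheory.EllipticCurves.SatisfiesHeegnerHypothesis N'' K →
    ∀ (κ : Literature.NumberTheory.EllipticCurves.ZpExtension K 3), κ.IsAnticyclotomic →
      ∀ (γ : Field.absoluteGaloisGroup K) [Fact (κ.IsTopGenerator γ)]
        (𝔭 : IsDedekindDomain.HeightOneSpectrum (NumberField.RingOfIntegers K)),
        ((3 : ℕ) : NumberField.RingOfIntegers K) ∈ 𝔭.asIdeal →
        𝔭.asIdeal.ramificationIdx (NumberField.RingOfIntegers ℚ) = 1 →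
        𝔭.asIdeal.inertiaDeg (NumberField.RingOfIntegers ℚ) = 1 →
        ∀ (𝔭' : IsDedekindDomain.HeightOneSpectrum (NumberField.RingOfIntegers K)),
        ((3 : ℕ) : NumberField.RingOfIntegers K) ∈ 𝔭'.asIdeal → 𝔭' ≠ 𝔭 →
        ∀ (ι' : PadicAlgCl 3 ≃+* ℂ), Summit.BirchSwinnertonDyer.BirchSwinnertonDyer.Theorems.SchneiderFree.BranchInducesPrime 3 ι' 𝔭 →
          (∃ (ΩK : ℂ) (Ωp : ℂ_[3]) (L' : Literature.NumberTheory.EllipticCurves.UnrSeries 3), ΩK ≠ 0 ∧ Ωp ≠ 0 ∧ Literature.NumberTheory.EllipticCurves.IsBDPLFunction ι' 𝔭 κ γ Dt'.f ΩK Ωp L') →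
          (∀ (ΩK : ℂ) (Ωp : ℂ_[3]) (L' : Literature.NumberTheory.EllipticCurves.UnrSeries 3), ΩK ≠ 0 → Ωp ≠ 0 → Literature.NumberTheory.EllipticCurves.IsBDPLFunction ι' 𝔭 κ γ Dt'.f ΩK Ωp L' →
            (Summit.BirchSwinnertonDyer.Rank1Residual.X11b.AcSelmer.XAc.charIdeal (W'.baseChange K) 3 κ 𝔭' ∅ γ).map (PowerSeries.map (Summit.BirchSwinnertonDyer.Rank1Residual.X11b.Halves.toUnr 3)) = Ideal.span {L'}) →
          (∀ (ΩK : ℂ) (Ωp : ℂ_[3]) (L'' : Literature.NumberTheory.EllipticCurves.UnrSeries 3), ΩK ≠ 0 → Ωp ≠ 0 → Literature.NumberTheory.EllipticCurves.IsBDPLFunction ι' 𝔭 κ γ Dt''.f ΩK Ωp L'' →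
            (Summit.BirchSwinnertonDyer.Rank1Residual.X11b.AcSelmer.XAc.charIdeal (W''.baseChange K) 3 κ 𝔭' ∅ γ).map (PowerSeries.map (Summit.BirchSwinnertonDyer.Rank1Residual.X11b.Halves.toUnr 3)) = Ideal.span {L''}) := by
  intro W _ _ W' _ _ W'' _ _ N N' N'' _ _ _ K _ _ Dt' Dt'' _ honto _ _ _ _ _ hcong'' haddv'' hN'' hK _ _
    hH'' κ hκ γ _ 𝔭 h𝔭 he hf 𝔭' h𝔭' hne ι' hι' _ _
  exact (hI W'' N'' K Dt'' haddv'' (hasSurjectiveModNGaloisRep_of_modPCongruent hcong'' honto) hN'' hK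
    hH'' κ hκ γ 𝔭 h𝔭 he hf 𝔭' h𝔭' hne ι' hι').2

/-- **The descent stub is implied by the crux as stated**: its extra hypothesis (the equality at EVERY
semistable onto twin with Heegner level over `K`) contains the crux's hypothesis at the one twin `W′`.
[folklore] -/
theorem wildDescent_of_toricTransportModThree (hT : ToricTransportModThree) :
  ∀ (W : WeierstrassCurve ℚ) [W.IsElliptic] [W.IsGloballyMinimal]
    (W' : WeierstrassCurve ℚ) [W'.IsElliptic] [W'.IsGloballyMinimal]
    (N N' : ℕ) [NeZero N] [NeZero N'] (K : Type) [Field K] [NumberField K]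
    (Dt : Literature.NumberTheory.EllipticCurves.ModularForms.ModularParametrizationData W N) (Dt' : Literature.NumberTheory.EllipticCurves.ModularForms.ModularParametrizationData W' N'),
    Summit.BirchSwinnertonDyer.Rank1Residual.Additive.ClassO6 W 3 → W.HasSurjectiveModNGaloisRep 3 →
    W.analyticRank = 1 → W.conductorNorm ℤ = N →
    Summit.BirchSwinnertonDyer.Rank1Residual.O6.ModPCongruent W' W 3 →
    ¬ Literature.NumberTheory.EllipticCurves.Rank1Residual.Addv W' 3 → W'.conductorNorm ℤ = N' →
    Literature.NumberTheory.EllipticCurves.IsImaginaryQuadratic K →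
    Literature.NumberTheory.EllipticCurves.SatisfiesHeegnerHypothesis N K →
    Literature.NumberTheory.EllipticCurves.SatisfiesHeegnerHypothesis N' K →
    ∀ (κ : Literature.NumberTheory.EllipticCurves.ZpExtension K 3), κ.IsAnticyclotomic →
      ∀ (γ : Field.absoluteGaloisGroup K) [Fact (κ.IsTopGenerator γ)]
        (𝔭 : IsDedekindDomain.HeightOneSpectrum (NumberField.RingOfIntegers K)),
        ((3 : ℕ) : NumberField.RingOfIntegers K) ∈ 𝔭.asIdeal →
        𝔭.asIdeal.ramificationIdx (NumberField.RingOfIntegers ℚ) = 1 →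
        𝔭.asIdeal.inertiaDeg (NumberField.RingOfIntegers ℚ) = 1 →
        ∀ (𝔭' : IsDedekindDomain.HeightOneSpectrum (NumberField.RingOfIntegers K)),
        ((3 : ℕ) : NumberField.RingOfIntegers K) ∈ 𝔭'.asIdeal → 𝔭' ≠ 𝔭 →
        ∀ (ι' : PadicAlgCl 3 ≃+* ℂ), Summit.BirchSwinnertonDyer.BirchSwinnertonDyer.Theorems.SchneiderFree.BranchInducesPrime 3 ι' 𝔭 →
          (∃ (ΩK : ℂ) (Ωp : ℂ_[3]) (L' : Literature.NumberTheory.EllipticCurves.UnrSeries 3), ΩK ≠ 0 ∧ Ωp ≠ 0 ∧ Literature.NumberTheory.EllipticCurves.IsBDPLFunction ι' 𝔭 κ γ Dt'.f ΩK Ωp L') →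
          (∀ (W'' : WeierstrassCurve ℚ) [W''.IsElliptic] [W''.IsGloballyMinimal] (N'' : ℕ) [NeZero N'']
              (Dt'' : Literature.NumberTheory.EllipticCurves.ModularForms.ModularParametrizationData W'' N''),
              Summit.BirchSwinnertonDyer.Rank1Residual.O6.ModPCongruent W'' W 3 → ¬ Literature.NumberTheory.EllipticCurves.Rank1Residual.Addv W'' 3 →
              W''.conductorNorm ℤ = N'' → Literature.NumberTheory.EllipticCurves.SatisfiesHeegnerHypothesis N'' K →
              (∀ (ΩK : ℂ) (Ωp : ℂ_[3]) (L'' : Literature.NumberTheory.EllipticCurves.UnrSeries 3), ΩK ≠ 0 → Ωp ≠ 0 → Literature.NumberTheory.EllipticCurves.IsBDPLFunction ι' 𝔭 κ γ Dt''.f ΩK Ωp L'' →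
            (Summit.BirchSwinnertonDyer.Rank1Residual.X11b.AcSelmer.XAc.charIdeal (W''.baseChange K) 3 κ 𝔭' ∅ γ).map (PowerSeries.map (Summit.BirchSwinnertonDyer.Rank1Residual.X11b.Halves.toUnr 3)) = Ideal.span {L''})) →
          (∀ (ΩK : ℂ) (Ωp : ℂ_[3]) (L : Literature.NumberTheory.EllipticCurves.UnrSeries 3), ΩK ≠ 0 → Ωp ≠ 0 → Literature.NumberTheory.EllipticCurves.IsBDPLFunction ι' 𝔭 κ γ Dt.f ΩK Ωp L →
            (Summit.BirchSwinnertonDyer.Rank1Residual.X11b.AcSelmer.XAc.charIdeal (W.baseChange K) 3 κ 𝔭' ∅ γ).map (PowerSeries.map (Summit.BirchSwinnertonDyer.Rank1Residual.X11b.Halves.toUnr 3)) = Ideal.span {L}) := by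
  intro W _ _ W' _ _ N N' _ _ K _ _ Dt Dt' hO6 honto hr hN hcong haddv hN' hK hH hH' κ hκ γ _ 𝔭 h𝔭 he hf
    𝔭' h𝔭' hne ι' hι' hex hall
  exact hT W W' N N' K Dt Dt' hO6 honto hr hN hcong haddv hN' hK hH hH' κ hκ γ 𝔭 h𝔭 he hf 𝔭' h𝔭' hne
    ι' hι' hex (hall W' N' Dt' hcong haddv hN' hH')

/-- **Conversely, granted crux #3 the descent stub gives the crux back** (crux #3 supplies the equality
at every twin `W″`, onto mod `3` by transport). Together with `wildDescent_of_toricTransportModThree`: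
modulo `TwinSplitIMCAtThree` — an input of the kernel `ToricKernelAtThree` in any case — the crux
`ToricTransportModThree` is equivalent to the descent stub alone; the spread stub is route-redundant.
[folklore] -/
theorem toricTransportModThree_of_twinSplitIMCAtThree_of_wildDescent (hI : TwinSplitIMCAtThree)
    (hD :   ∀ (W : WeierstrassCurve ℚ) [W.IsElliptic] [W.IsGloballyMinimal]
        (W' : WeierstrassCurve ℚ) [W'.IsElliptic] [W'.IsGloballyMinimal]
        (N N' : ℕ) [NeZero N] [NeZero N'] (K : Type) [Field K] [NumberField K]
        (Dt : Literature.NumberTheory.EllipticCurves.ModularForms.ModularParametrizationData W N) (Dt' : Literature.NumberTheory.EllipticCurves.ModularForms.ModularParametrizationData W' N'),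
        Summit.BirchSwinnertonDyer.Rank1Residual.Additive.ClassO6 W 3 → W.HasSurjectiveModNGaloisRep 3 →
        W.analyticRank = 1 → W.conductorNorm ℤ = N →
        Summit.BirchSwinnertonDyer.Rank1Residual.O6.ModPCongruent W' W 3 →
        ¬ Literature.NumberTheory.EllipticCurves.Rank1Residual.Addv W' 3 → W'.conductorNorm ℤ = N' →
        Literature.NumberTheory.EllipticCurves.IsImaginaryQuadratic K →
        Literature.NumberTheory.EllipticCurves.SatisfiesHeegnerHypothesis N K →
        Literature.NumberTheory.EllipticCurves.SatisfiesHeegnerHypothesis N' K →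
        ∀ (κ : Literature.NumberTheory.EllipticCurves.ZpExtension K 3), κ.IsAnticyclotomic →
          ∀ (γ : Field.absoluteGaloisGroup K) [Fact (κ.IsTopGenerator γ)]
            (𝔭 : IsDedekindDomain.HeightOneSpectrum (NumberField.RingOfIntegers K)),
            ((3 : ℕ) : NumberField.RingOfIntegers K) ∈ 𝔭.asIdeal →
            𝔭.asIdeal.ramificationIdx (NumberField.RingOfIntegers ℚ) = 1 →
            𝔭.asIdeal.inertiaDeg (NumberField.RingOfIntegers ℚ) = 1 →
            ∀ (𝔭' : IsDedekindDomain.HeightOneSpectrum (NumberField.RingOfIntegers K)),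
            ((3 : ℕ) : NumberField.RingOfIntegers K) ∈ 𝔭'.asIdeal → 𝔭' ≠ 𝔭 →
            ∀ (ι' : PadicAlgCl 3 ≃+* ℂ), Summit.BirchSwinnertonDyer.BirchSwinnertonDyer.Theorems.SchneiderFree.BranchInducesPrime 3 ι' 𝔭 →
              (∃ (ΩK : ℂ) (Ωp : ℂ_[3]) (L' : Literature.NumberTheory.EllipticCurves.UnrSeries 3), ΩK ≠ 0 ∧ Ωp ≠ 0 ∧ Literature.NumberTheory.EllipticCurves.IsBDPLFunction ι' 𝔭 κ γ Dt'.f ΩK Ωp L') →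
              (∀ (W'' : WeierstrassCurve ℚ) [W''.IsElliptic] [W''.IsGloballyMinimal] (N'' : ℕ) [NeZero N'']
                  (Dt'' : Literature.NumberTheory.EllipticCurves.ModularForms.ModularParametrizationData W'' N''),
                  Summit.BirchSwinnertonDyer.Rank1Residual.O6.ModPCongruent W'' W 3 → ¬ Literature.NumberTheory.EllipticCurves.Rank1Residual.Addv W'' 3 →
                  W''.conductorNorm ℤ = N'' → Literature.NumberTheory.EllipticCurves.SatisfiesHeegnerHypothesis N'' K →
                  (∀ (ΩK : ℂ) (Ωp : ℂ_[3]) (L'' : Literature.NumberTheory.EllipticCurves.UnrSeries 3), ΩK ≠ 0 → Ωp ≠ 0 → Literature.NumberTheory.EllipticCurves.IsBDPLFunction ι' 𝔭 κ γ Dt''.f ΩK Ωp L'' →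
                (Summit.BirchSwinnertonDyer.Rank1Residual.X11b.AcSelmer.XAc.charIdeal (W''.baseChange K) 3 κ 𝔭' ∅ γ).map (PowerSeries.map (Summit.BirchSwinnertonDyer.Rank1Residual.X11b.Halves.toUnr 3)) = Ideal.span {L''})) →
              (∀ (ΩK : ℂ) (Ωp : ℂ_[3]) (L : Literature.NumberTheory.EllipticCurves.UnrSeries 3), ΩK ≠ 0 → Ωp ≠ 0 → Literature.NumberTheory.EllipticCurves.IsBDPLFunction ι' 𝔭 κ γ Dt.f ΩK Ωp L →
                (Summit.BirchSwinnertonDyer.Rank1Residual.X11b.AcSelmer.XAc.charIdeal (W.baseChange K) 3 κ 𝔭' ∅ γ).map (PowerSeries.map (Summit.BirchSwinnertonDyer.Rank1Residual.X11b.Halves.toUnr 3)) = Ideal.span {L})) :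
    ToricTransportModThree := by
  intro W _ _ W' _ _ N N' _ _ K _ _ Dt Dt' hO6 honto hr hN hcong haddv hN' hK hH hH' κ hκ γ _ 𝔭 h𝔭 he hf
    𝔭' h𝔭' hne ι' hι' hex _
  exact hD W W' N N' K Dt Dt' hO6 honto hr hN hcong haddv hN' hK hH hH' κ hκ γ 𝔭 h𝔭 he hf 𝔭' h𝔭' hne
    ι' hι' hex (fun W'' _ _ N'' _ Dt'' hcong'' haddv'' hN'' hH'' =>
      (hI W'' N'' K Dt'' haddv'' (hasSurjectiveModNGaloisRep_of_modPCongruent hcong'' honto) hN'' hK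
        hH'' κ hκ γ 𝔭 h𝔭 he hf 𝔭' h𝔭' hne ι' hι').2)

end Summit.BirchSwinnertonDyer.BirchSwinnertonDyer.Theorems.UniversalToricDescentReduction

end
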